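import Summits.CriticalPhenomena.PercolationContinuityZ3.Theorems.FK.DLRClosedBoundaryFree
import Summits.CriticalPhenomena.PercolationContinuityZ3.Theorems.FK.UniquenessOfNonPercolation
import Summits.CriticalPhenomena.PercolationContinuityZ3.Theorems.FK.GibbsThetaSandwich
import Summits.CriticalPhenomena.PercolationContinuityZ3.Theorems.FK.UniquenessInfiniteClusterFK
import Summits.CriticalPhenomena.PercolationContinuityZ3.Theorems.FK.FreeWiredCriticalPoint
import HarnessLib

/-!
# FK-continuity cell, FO-10a: every DLR random-cluster measure WITHOUT infinite clusters is `φ⁰_{p,q}` —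
# uniqueness of the non-percolating state in `R_{p,q}` (Grimmett 2006, Thm. (5.33)(a) remark / ACCN 1988 Thm. A.2,
# for an arbitrary member of `R_{p,q}`)

Registered R78 (cell INBOX l.5727, 2026-08-23); registry row FO-10a-g336f; label DFR-B (coordinator fk-4 g167).
Cell `fk-continuity` (bschramm), row FO-10a (domain-Markov + comparison layer over FO-06); support file for the
FK-continuity transplant (`--supports stmt-CriticalPhenomena-4575`); builds on p205010 (kernel theorem, internal audit
signed; external expert review pending). Pure proofs; no definitions, no named facts, no sorries; general dimension `d`.

`UniquenessOfNonPercolation.lean` (row FO-10a-g335, NPC-B) proved: a BOX LIMIT without infinite clusters lies below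
every measure of the sandwich class on increasing local events (exploration from outside: on each free island the
configuration is free). With the free Markov property of a DLR measure across a closed edge boundary
(`DLRClosedBoundaryFree.lean`) the same exploration runs for an ARBITRARY lattice-carried DLR random-cluster measure:

* `IsDLRRandomCluster.real_inter_setOf_forall_not_bdryReach_le` — `P(A ∩ {Λ ↮ ∂Δ inside Δ}) ≤ P'(A)` for `P ∈ R_{p,q}`,
  `P'` of the class `FKGibbs d p q`, `A` increasing determined by `E_Λ`, `Λ ⊆ Δ`;
* **`IsDLRRandomCluster.real_le_of_forall_percolatesAt_eq_zero`** — if `P ∈ R_{p,q}` has no infinite cluster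
  (`P(x ↔ ∞) = 0` at every site) then `P(A) ≤ P'(A)` for every `P'` of the class and every increasing local `A`;
* **`IsDLRRandomCluster.eq_rcLimit_false_of_forall_percolatesAt_eq_zero`** — hence **`P = φ⁰_{p,q}`**: the
  non-percolating DLR state, when it exists, is unique and equals the free measure (`0 < p < 1`, `q ≥ 1`, every `d`);
  `isDLRRandomCluster_and_forall_percolatesAt_eq_zero_iff` (`P` is a non-percolating lattice DLR measure iff
  `P = φ⁰_{p,q}` and `θ⁰(p,q) = 0`);
* `IsDLRRandomCluster.exists_measure_percolatesAt_ne_zero_of_thetaFree_pos` — **if `θ⁰(p,q) > 0` (e.g. `p > p_c(q)`),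
  EVERY DLR random-cluster measure percolates**; `IsDLRRandomCluster.exists_measure_percolatesAt_ne_zero_of_rcCriticalProb_lt`.

Compared with `DLRUniqueness.lean` (row FO-10a-g335d: `θ¹(p,q) = 0 ⇒ |R_{p,q}| = 1`) the hypothesis here is on the
measure `P` itself, not on the wired phase: at a point of phase coexistence (`θ⁰ = 0 < θ¹`, e.g. `p = p_c(q)` for
large `q`, Thm. (7.33)) it says that `φ⁰_{p_c,q}` is the ONLY non-percolating DLR state.

Honest framing: unconditional structure; decides nothing about `q ∈ (1,2)` at `p_c(q)`; NOT a binder discharge, NOT `_r4`.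

## References
* G. Grimmett, *The Random-Cluster Model*, Springer 2006 (`book:grimmett2006-random-cluster-model`): Lemma (4.13),
  Thm. (4.19) (4.21)/(4.24), Def. (4.29)–(4.30), Thm. (4.34) (4.35)–(4.36); §5.2 proof of Thm. (5.16)(c) (the set G);
  §5.3 Thm. (5.33)(a) and the remark after it [PDF pp. 71–82, 103–107]. [Grimmett2006]
* M. Aizenman, J. T. Chayes, L. Chayes, C. M. Newman, J. Stat. Phys. 50 (1988) 1–40, Thm. A.2. [AizenmanChayesChayesNewman1988]
-/

noncomputable section

open MeasureTheory Set Filter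
open scoped Topology ENNReal

namespace Summit.CriticalPhenomena.PercolationContinuityZ3.Theorems.FK

open Literature.Probability.Percolation Literature.Probability.LatticeModels Literature.Barriers.CriticalPhenomena

variable {d : ℕ} {p q : ℝ} {P P' : Measure (BondConfig (Site d))}

/-! ### The estimate inside the free islands, for a DLR measure -/

/-- **Summing over the free islands, DLR version**: for `P ∈ R_{p,q}` carried by lattice configurations
(`0 < p < 1`, `q > 0`), `P'` of the class `FKGibbs d p q`, finite `Λ ⊆ Δ` and an increasing `A` determined by
`E_Λ`: `P(A ∩ {no vertex of Λ is joined to ∂Δ inside Δ}) ≤ P'(A)` — on each island the configuration is free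
(`IsDLRRandomCluster.real_inter_le_of_closed`). Proof as NPC-B's `IsBoxLimit.real_inter_setOf_forall_not_bdryReach_le`.
[cite: Grimmett2006, §5.2 proof of Thm. (5.16)(c) with Lemma (4.13) and (4.21)/(4.24), inside (4.30)] -/
theorem IsDLRRandomCluster.real_inter_setOf_forall_not_bdryReach_le (hP : IsDLRRandomCluster d p q P)
    (hE : ∀ᵐ ω ∂P, ω ⊆ (zdGraph d).edgeSet) (hp : p ∈ Set.Ioo (0 : ℝ) 1) (hq : 0 < q) (hP' : FKGibbs d p q P')
    {Λ Δ : Finset (Site d)} (hΛΔ : Λ ⊆ Δ) {A : Set (BondConfig (Site d))} (hA : IsUpperSet A)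
    (hAΛ : DeterminedBy A ↑(edgesIn (zdGraph d) Λ)) :
    P.real (A ∩ {ω | ∀ x ∈ Λ, ¬ ∃ y ∈ innerBoundary (zdGraph d) Δ,
        (openGraph ω ⊓ withinGraph (zdGraph d) (↑Δ : Set (Site d))).Reachable y x}) ≤ P'.real A := by
  classical
  haveI := hP.isProbabilityMeasure
  set I : Finset (Site d) → Set (BondConfig (Site d)) := fun g =>
    {ω | ∀ x, x ∈ g ↔ x ∈ Δ ∧ ¬ ∃ y ∈ innerBoundary (zdGraph d) Δ,
      (openGraph ω ⊓ withinGraph (zdGraph d) (↑Δ : Set (Site d))).Reachable y x} with hI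
  set 𝒢 : Finset (Finset (Site d)) := Δ.powerset.filter (fun g => Λ ⊆ g) with h𝒢
  have hIm : ∀ g, MeasurableSet (I g) := fun g =>
    measurableSet_of_isLocalEvent_holds ⟨_, determinedBy_setOf_island Δ g⟩
  have hdisj : (↑𝒢 : Set (Finset (Site d))).PairwiseDisjoint I := fun g _ g' _ hne =>
    disjoint_setOf_island Δ hne
  have hdisjA : (↑𝒢 : Set (Finset (Site d))).PairwiseDisjoint (fun g => A ∩ I g) := fun g hg g' hg' hne =>
    (hdisj hg hg' hne).mono Set.inter_subset_right Set.inter_subset_right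
  have hAm : MeasurableSet A := measurableSet_of_isLocalEvent_holds ⟨_, hAΛ⟩
  have hterm : ∀ g ∈ 𝒢, P.real (A ∩ I g) ≤ P'.real A * P.real (I g) := by
    intro g hg
    rw [h𝒢, Finset.mem_filter, Finset.mem_powerset] at hg
    refine hP.real_inter_le_of_closed hE hp hq hP' g (edgesIn (zdGraph d) Δ \ edgesIn (zdGraph d) g) hA
      (hAΛ.mono (edgesIn_subset_edgesIn_of_subset hg.2)) ?_ (determinedBy_setOf_island Δ g) ?_
    · rw [Finset.coe_sdiff]
      exact disjoint_sdiff_left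
    · intro ω hω x hx y hy hxy
      exact not_mem_of_island hω hx hy hxy
  haveI := hP'.isProbabilityMeasure
  rw [setOf_forall_not_bdryReach_eq_biUnion hΛΔ, Set.inter_iUnion₂]
  change P.real (⋃ g ∈ 𝒢, A ∩ I g) ≤ P'.real A
  rw [measureReal_biUnion_finset hdisjA (fun g _ => hAm.inter (hIm g))]
  calc ∑ g ∈ 𝒢, P.real (A ∩ I g) ≤ ∑ g ∈ 𝒢, P'.real A * P.real (I g) := Finset.sum_le_sum hterm
    _ = P'.real A * P.real (⋃ g ∈ 𝒢, I g) := by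
        rw [← Finset.mul_sum, measureReal_biUnion_finset hdisj (fun g _ => hIm g)]
    _ ≤ P'.real A * 1 := mul_le_mul_of_nonneg_left measureReal_le_one measureReal_nonneg
    _ = P'.real A := mul_one _

/-! ### A non-percolating DLR measure lies below the class; hence it is `φ⁰_{p,q}` -/

/-- **A DLR random-cluster measure without infinite clusters lies below every sandwich measure on increasing local
events**: if `P ∈ R_{p,q}` is carried by lattice configurations (`0 < p < 1`, `q > 0`) and `P(x ↔ ∞) = 0` at every
site, then `P(A) ≤ P'(A)` for every `FKGibbs d p q P'` and every increasing `A` determined by the edges of a finite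
region: `P(A) ≤ P(A; Λ ↮ ∂Λ_{k+1}) + Σ_{x ∈ Λ} P(x ↔ Λ_kᶜ)`, the first term `≤ P'(A)`, the second `→ 0`. Proof as
NPC-B's `IsBoxLimit.real_le_of_forall_percolatesAt_eq_zero`. [cite: Grimmett2006, Thm. (5.33)(a) and the remark after it ([8, Thm A.2]), with (4.30)] -/
theorem IsDLRRandomCluster.real_le_of_forall_percolatesAt_eq_zero (hP : IsDLRRandomCluster d p q P)
    (hE : ∀ᵐ ω ∂P, ω ⊆ (zdGraph d).edgeSet) (hp : p ∈ Set.Ioo (0 : ℝ) 1) (hq : 0 < q)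
    (hperc : ∀ x : Site d, P (percolatesAt x) = 0) (hP' : FKGibbs d p q P') {A : Set (BondConfig (Site d))}
    {Λ : Finset (Site d)} (hA : IsUpperSet A) (hAΛ : DeterminedBy A ↑(edgesIn (zdGraph d) Λ)) :
    P.real A ≤ P'.real A := by
  classical
  haveI := hP.isProbabilityMeasure
  -- the events `{x ↔ Λ_kᶜ}`
  set C : ℕ → Site d → Set (BondConfig (Site d)) := fun k x =>
    ⋃ z ∈ (↑(box d k) : Set (Site d))ᶜ, openConn x z with hC
  have hCm : ∀ k x, MeasurableSet (C k x) := fun k x =>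
    MeasurableSet.biUnion (Set.to_countable _) fun z _ => measurableSet_openConn_holds x z
  have hCanti : ∀ x, Antitone fun k => C k x := by
    intro x k l hkl ω hω
    simp only [hC, Set.mem_iUnion, Set.mem_compl_iff, Finset.mem_coe, exists_prop] at hω ⊢
    obtain ⟨z, hz, hωz⟩ := hω
    exact ⟨z, fun h => hz (box_mono d hkl h), hωz⟩
  have hCsub : ∀ x, (⋂ k, C k x) ⊆ percolatesAt x := by
    intro x ω hω
    simp only [Set.mem_iInter, hC, Set.mem_iUnion, Set.mem_compl_iff, Finset.mem_coe, exists_prop] at hω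
    intro hfin
    obtain ⟨z, hz, hωz⟩ := hω (hfin.toFinset.sup siteRad)
    exact hz (subset_box_of_sup_siteRad_le le_rfl (hfin.mem_toFinset.2 hωz))
  have hClim : ∀ x, Tendsto (fun k => P.real (C k x)) atTop (𝓝 0) := by
    intro x
    have h1 : Tendsto (fun k => P (C k x)) atTop (𝓝 (P (⋂ k, C k x))) :=
      tendsto_measure_iInter_atTop (fun k => (hCm k x).nullMeasurableSet) (hCanti x) ⟨0, measure_ne_top _ _⟩
    have h0 : P (⋂ k, C k x) = 0 := measure_mono_null (hCsub x) (hperc x)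
    rw [h0] at h1
    have h2 := (ENNReal.tendsto_toReal ENNReal.zero_ne_top).comp h1
    rw [ENNReal.toReal_zero] at h2
    exact h2.congr fun k => rfl
  have hbound : ∀ k, Λ.sup siteRad ≤ k → P.real A ≤ P'.real A + ∑ x ∈ Λ, P.real (C k x) := by
    intro k hk
    have hΛΔ : Λ ⊆ box d (k + 1) := subset_box_of_sup_siteRad_le (by omega)
    set E : Set (BondConfig (Site d)) := {ω | ∀ x ∈ Λ, ¬ ∃ y ∈ innerBoundary (zdGraph d) (box d (k + 1)),
      (openGraph ω ⊓ withinGraph (zdGraph d) (↑(box d (k + 1)) : Set (Site d))).Reachable y x} with hEdef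
    have h1 : P.real (A ∩ E) ≤ P'.real A :=
      hP.real_inter_setOf_forall_not_bdryReach_le hE hp hq hP' hΛΔ hA hAΛ
    have hEc : Eᶜ ⊆ ⋃ x ∈ Λ, C k x := by
      intro ω hω
      rw [Set.mem_compl_iff, hEdef, Set.mem_setOf_eq] at hω
      push Not at hω
      obtain ⟨x, hx, y, hy, hyx⟩ := hω
      simp only [Set.mem_iUnion, hC, Set.mem_compl_iff, Finset.mem_coe, exists_prop]
      refine ⟨x, hx, y, fun hyk => notMem_innerBoundary_box_of_mem_box (Nat.lt_succ_self k) hyk hy, ?_⟩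
      exact (hyx.mono inf_le_left).symm
    calc P.real A ≤ P.real (A ∩ E ∪ Eᶜ) := by
          refine measureReal_mono fun ω hω => ?_
          by_cases hωE : ω ∈ E
          · exact Or.inl ⟨hω, hωE⟩
          · exact Or.inr hωE
      _ ≤ P.real (A ∩ E) + P.real Eᶜ := measureReal_union_le _ _
      _ ≤ P'.real A + P.real (⋃ x ∈ Λ, C k x) :=
          add_le_add h1 (measureReal_mono hEc (measure_ne_top _ _))
      _ ≤ P'.real A + ∑ x ∈ Λ, P.real (C k x) := by
          gcongr
          exact measureReal_biUnion_finset_le _ _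
  have hlim : Tendsto (fun k => P'.real A + ∑ x ∈ Λ, P.real (C k x)) atTop (𝓝 (P'.real A + ∑ x ∈ Λ, (0 : ℝ))) :=
    tendsto_const_nhds.add (tendsto_finsetSum Λ fun x _ => hClim x)
  rw [Finset.sum_const_zero, add_zero] at hlim
  exact ge_of_tendsto hlim (Filter.eventually_atTop.2 ⟨Λ.sup siteRad, hbound⟩)

/-- **Every DLR random-cluster measure without infinite clusters is `φ⁰_{p,q}`** (`0 < p < 1`, `q ≥ 1`, every `d`;
`P ∈ R_{p,q}` carried by lattice configurations, `P(x ↔ ∞) = 0` at every site): `P ≤ φ⁰_{p,q}` on increasing cylinders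
by the previous theorem and `φ⁰_{p,q} ≤ P` by the sandwich (`DLRSandwich.lean`), so the two probability measures agree
on the increasing cylinders `{E₀ ⊆ ω}`. The non-percolating state of `R_{p,q}`, when it exists, is unique.
[cite: Grimmett2006, Thm. (5.33)(a) and the remark after it ([8, Thm A.2]); Thm. (4.34) eq. (4.35)] -/
theorem IsDLRRandomCluster.eq_rcLimit_false_of_forall_percolatesAt_eq_zero (hP : IsDLRRandomCluster d p q P)
    (hE : ∀ᵐ ω ∂P, ω ⊆ (zdGraph d).edgeSet) (hp : p ∈ Set.Ioo (0 : ℝ) 1) (hq : 1 ≤ q)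
    (hperc : ∀ x : Site d, P (percolatesAt x) = 0) : P = rcLimit d false p q := by
  classical
  haveI := hP.isProbabilityMeasure
  have hp' : p ∈ Set.Icc (0 : ℝ) 1 := ⟨hp.1.le, hp.2.le⟩
  have hq0 : 0 < q := one_pos.trans_le hq
  haveI := isProbabilityMeasure_rcLimit false p q (d := d)
  have hG : FKGibbs d p q P := hP.fkGibbs hp hq hE
  have hG0 : FKGibbs d p q (rcLimit d false p q) := (isBoxLimit_rcLimit false hp' hq).fkGibbs hp' hq
  refine ext_of_setOf_subset fun E₀ => ?_
  have hAu : IsUpperSet {ω : BondConfig (Site d) | (↑E₀ : Set (Sym2 (Site d))) ⊆ ω} :=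
    fun ω ω' hle hω => Set.Subset.trans hω hle
  by_cases hE₀ : (↑E₀ : Set (Sym2 (Site d))) ⊆ (zdGraph d).edgeSet
  · -- a lattice cylinder is determined by the edges of the box spanned by its pairs
    have hdet : DeterminedBy {ω : BondConfig (Site d) | (↑E₀ : Set (Sym2 (Site d))) ⊆ ω}
        ↑(edgesIn (zdGraph d) (box d (E₀.sup pairRad))) := by
      refine (determinedBy_setOf_subset E₀).mono fun e he => ?_
      rw [Finset.mem_coe, mem_edgesIn_iff]
      exact ⟨hE₀ he, mem_box_of_pairRad_le (Finset.le_sup (Finset.mem_coe.1 he))⟩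
    -- `φ⁰ ≤ P` (sandwich) and `P ≤ φ⁰` (no infinite cluster)
    have hge := hG.rcLimit_false_real_le hp' hq hAu hdet
    have hle := hP.real_le_of_forall_percolatesAt_eq_zero hE hp hq0 hperc hG0 hAu hdet
    exact (ENNReal.toReal_eq_toReal_iff' (measure_ne_top _ _) (measure_ne_top _ _)).1 (le_antisymm hle hge)
  · -- a non-lattice pair is almost surely closed under both measures
    rw [Set.not_subset] at hE₀
    obtain ⟨e, he, heE⟩ := hE₀
    have h0 : ∀ μ : Measure (BondConfig (Site d)), (∀ᵐ ω ∂μ, ω ⊆ (zdGraph d).edgeSet) →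
        μ {ω | (↑E₀ : Set (Sym2 (Site d))) ⊆ ω} = 0 := by
      intro μ hμ
      refine measure_mono_null (fun ω hω => ?_) (ae_iff.1 hμ)
      exact fun hωE => heE (hωE (hω he))
    rw [h0 P hE, h0 (rcLimit d false p q) hG0.ae_subset_edgeSet]

/-- **Characterisation of the non-percolating DLR states**: a measure is a lattice-carried DLR random-cluster measure
without infinite clusters iff it is `φ⁰_{p,q}` AND `θ⁰(p,q) = 0` (`0 < p < 1`, `q ≥ 1`). [cite: Grimmett2006, Thm. (5.33)(a) remark, Thm. (4.34)(b), §5.1 (5.1)] -/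
theorem isDLRRandomCluster_and_forall_percolatesAt_eq_zero_iff (hp : p ∈ Set.Ioo (0 : ℝ) 1) (hq : 1 ≤ q) :
    (IsDLRRandomCluster d p q P ∧ (∀ᵐ ω ∂P, ω ⊆ (zdGraph d).edgeSet) ∧ ∀ x : Site d, P (percolatesAt x) = 0) ↔
      P = rcLimit d false p q ∧ thetaFree d p q = 0 := by
  have hp' : p ∈ Set.Icc (0 : ℝ) 1 := ⟨hp.1.le, hp.2.le⟩
  constructor
  · rintro ⟨hP, hE, hperc⟩
    have heq := hP.eq_rcLimit_false_of_forall_percolatesAt_eq_zero hE hp hq hperc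
    refine ⟨heq, ?_⟩
    rw [← rcLimit_false_real_percolatesAt hp' hq, measureReal_def, ← heq, hperc 0, ENNReal.toReal_zero]
  · rintro ⟨rfl, hθ⟩
    refine ⟨isDLRRandomCluster_rcLimit false hp' hq, ((isBoxLimit_rcLimit false hp' hq).fkGibbs hp' hq).ae_subset_edgeSet,
      fun x => ?_⟩
    haveI := isProbabilityMeasure_rcLimit false p q (d := d)
    have h0 : (rcLimit d false p q).real (percolatesAt x) = 0 := by
      rw [(isBoxLimit_rcLimit false hp' hq).real_percolatesAt_eq_real_percolatesAt_zero hp' hq x,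
        rcLimit_false_real_percolatesAt hp' hq, hθ]
    exact (measureReal_eq_zero_iff (measure_ne_top _ _)).1 h0

/-- **If `θ⁰(p,q) > 0`, every DLR random-cluster measure percolates** (`0 < p < 1`, `q ≥ 1`; `P ∈ R_{p,q}` carried by
lattice configurations): some site is joined to infinity with positive `P`-probability. [cite: Grimmett2006, Thm. (5.33)(a) remark with §5.1 (5.1)–(5.3)] -/
theorem IsDLRRandomCluster.exists_measure_percolatesAt_ne_zero_of_thetaFree_pos (hP : IsDLRRandomCluster d p q P)
    (hE : ∀ᵐ ω ∂P, ω ⊆ (zdGraph d).edgeSet) (hp : p ∈ Set.Ioo (0 : ℝ) 1) (hq : 1 ≤ q) (hθ : 0 < thetaFree d p q) :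
    ∃ x : Site d, P (percolatesAt x) ≠ 0 := by
  by_contra h
  push Not at h
  have := ((isDLRRandomCluster_and_forall_percolatesAt_eq_zero_iff hp hq).1 ⟨hP, hE, h⟩).2
  exact hθ.ne' this

/-- **Above `p_c(q)` every DLR random-cluster measure percolates** (`p_c(q) < p < 1`, `q ≥ 1`). [cite: Grimmett2006, §5.1 (5.1)–(5.3) with Thm. (5.33)(a) remark] -/
theorem IsDLRRandomCluster.exists_measure_percolatesAt_ne_zero_of_rcCriticalProb_lt (hP : IsDLRRandomCluster d p q P)
    (hE : ∀ᵐ ω ∂P, ω ⊆ (zdGraph d).edgeSet) (hp : p ∈ Set.Ioo (0 : ℝ) 1) (hq : 1 ≤ q) (hlt : rcCriticalProb d q < p) :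
    ∃ x : Site d, P (percolatesAt x) ≠ 0 :=
  hP.exists_measure_percolatesAt_ne_zero_of_thetaFree_pos hE hp hq
    (thetaFree_pos_of_rcCriticalProb_lt hq ⟨hp.1.le, hp.2.le⟩ hlt)

end Summit.CriticalPhenomena.PercolationContinuityZ3.Theorems.FK

end
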